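import Literature.AlgebraicGeometry.Motives.CartesianNatIsoMonoidal
import Literature.AlgebraicGeometry.Motives.AbelianVarietyBaseChange
import HarnessLib

/-!
# Monoidality of a tower isomorphism of base-change functors `(− ⊗_k L) ⊗_L M ≅ − ⊗_k M`

Topic `Literature/AlgebraicGeometry/Motives`; consumers: the (G)-road of the `hodgecm-mathlib` cell
(`Liu2021/AlbaneseBaseChangeFiniteGalois` «G4ℂ», `Liu2021/Lemma24OfJacobianDimension` «F6»), which move an
Albanese chart `E_c ⊗ E_c ⟶ (∇X)_L ↪ (X ⊗ X)_L` from `L` to `ℂ` along `k → L → ℂ`.  THEOREMS ONLY (D-0026 ±0).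

For fields `k → L`, `L → M`, `k → M` and ANY natural isomorphism
`e : bcFunctor k L ⋙ bcFunctor L M ≅ bcFunctor k M` of the base-change functors on `k`-schemes
(`bcFunctor K L = Over.pullback (Spec L → Spec K)`, cartesian monoidal for the fibre product over the base;
the tower isomorphism `AbelianVariety.bcFunctorTowerIso k L M` of `Motives/AbelianVarietyBaseChangeTower` is the
intended instance), this file records, in the spelling used by the consumers (`(e.app X).hom`,
`Functor.LaxMonoidal.μ (bcFunctor L M) …`):

* `bcTower_map_map_comp_app_hom` — naturality `((f ⊗_k L) ⊗_L M) ≫ e_Y = e_X ≫ (f ⊗_k M)` (and the `inv` form, and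
  `bcTower_comp_app_hom_comp_map`, the form `m ≫ e_X ≫ (f ⊗_k M) = …` that rewrites inside composites);
* `bcTower_μ_comp_map_μ_comp_app_hom` — **`e` is monoidal**: `μ_{LM} ≫ (μ_{kL} ⊗_L M) ≫ e_{X ⊗ Y} = (e_X ⊗ e_Y) ≫ μ_{kM}`
  (every natural isomorphism of cartesian functors is monoidal: `Motives/CartesianNatIsoMonoidal`);
* the `δ`-form, the chart forms `μ_{LM} ≫ ((g ⊗ g′) ≫ μ_{kL}) ⊗_L M ≫ e_{X⊗Y} = ((g_M ≫ e_X) ⊗ (g′_M ≫ e_Y)) ≫ μ_{kM}`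
  (`bcTower_μ_comp_map_tensorHom_μ_comp_app_hom`, with its `δ`-prefixed and diagonal `lift u u′` variants), and the
  packaged chart transport `bcTower_chart_comp_map_eq` (hypothesis `l ≫ (ι ⊗_k L) = (g ⊗ g′) ≫ μ_{kL}`, conclusion
  `(μ_{LM} ≫ (l ⊗_L M) ≫ e_N) ≫ (ι ⊗_k M) = ((g_M ≫ e_X) ⊗ (g′_M ≫ e_Y)) ≫ μ_{kM}`).

KERNEL NOTE (farm-measured 2026-08-28, Lean kernel «deterministic timeout»).  With the CONCRETE tower isomorphism
`E := AbelianVariety.bcFunctorTowerIso k L M` (an `Over.pullbackComp` composed with an `eqToIso` of base-change functors)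
the kernel does not survive ANY definitional mismatch between a hand-written statement and the proof term's type —
`(E.app X).hom` vs `E.hom.app X` inside a composition, `(bcFunctor L M).map ((bcFunctor k L).map f)` vs
`(bcFunctor k L ⋙ bcFunctor L M).map f`, `Functor.Monoidal.μIso … .hom` vs `Functor.LaxMonoidal.μ`, or the two
instance paths to `(Over.pullback _).LaxMonoidal` — each such restatement of a law of `E` timed out, while the same
restatements for an ABSTRACT `e` (this file) check in seconds, and INSTANTIATING a lemma of this file at `e := E` is
a syntactic match (checked: `bcTower_μ_comp_map_μ_comp_hom_app (AbelianVariety.bcFunctorTowerIso k L ℂ) X Y` closes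
the literally restated law at `ℂ`).  RULE FOR CONSUMERS: obtain every law of `bcFunctorTowerIso` by applying a lemma
of this file to it, with your statement spelled token-for-token as here; never re-derive it through `Iso.app_hom`,
`Functor.comp_map`, `μIso_hom` or `simp` at the concrete isomorphism.

## References

* [GortzWedhorn2020] U. Görtz, T. Wedhorn, *Algebraic Geometry I*, 2nd ed. (2020), Prop. 4.16 (transitivity of fibre
  products `(X ×_S S′) ×_{S′} S″ = X ×_S S″`) and §(4.7) (base change commutes with fibre products) — the geometric
  content; the categorical statement (natural isomorphisms of cartesian functors are monoidal) is folklore.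
-/

noncomputable section

open CategoryTheory CategoryTheory.Limits MonoidalCategory CartesianMonoidalCategory

namespace Literature.AlgebraicGeometry.Motives

universe v₁ v₂ v₃ u₁ u₂ u₃ u

/-! ## §1 Two more shapes of «natural isomorphisms of cartesian functors are monoidal» (generic) -/

section General

variable {C : Type u₁} [Category.{v₁} C] [CartesianMonoidalCategory C]
  {D : Type u₂} [Category.{v₂} D] [CartesianMonoidalCategory D]
  {E : Type u₃} [Category.{v₃} E] [CartesianMonoidalCategory E]
  (F : C ⥤ D) (G : D ⥤ E) (H : C ⥤ E) [F.Monoidal] [G.Monoidal] [H.Monoidal]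

/-- **`μ`-prefixed chart shape** (components): for `g : Z ⟶ F X`, `g′ : Z′ ⟶ F Y`,
`μ_G ≫ G((g ⊗ g′) ≫ μ_F) ≫ e_{X ⊗ Y} = ((G g ≫ e_X) ⊗ (G g′ ≫ e_Y)) ≫ μ_H` (naturality of `μ_G`, then
`μ_G ≫ G(μ_F) ≫ e_{X⊗Y} = (e_X ⊗ e_Y) ≫ μ_H`). [cite: GortzWedhorn2020, §(4.7)] -/
theorem μ_comp_map_tensorHom_μ_comp_eq_of_naturality {X Y : C} (eX : G.obj (F.obj X) ≅ H.obj X)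
    (eY : G.obj (F.obj Y) ≅ H.obj Y) (eXY : G.obj (F.obj (X ⊗ Y)) ≅ H.obj (X ⊗ Y))
    (hfst : G.map (F.map (fst X Y)) ≫ eX.hom = eXY.hom ≫ H.map (fst X Y))
    (hsnd : G.map (F.map (snd X Y)) ≫ eY.hom = eXY.hom ≫ H.map (snd X Y)) {Z Z' : D} (g : Z ⟶ F.obj X)
    (g' : Z' ⟶ F.obj Y) :
    Functor.LaxMonoidal.μ G Z Z' ≫ G.map ((g ⊗ₘ g') ≫ Functor.LaxMonoidal.μ F X Y) ≫ eXY.hom =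
      ((G.map g ≫ eX.hom) ⊗ₘ (G.map g' ≫ eY.hom)) ≫ Functor.LaxMonoidal.μ H X Y := by
  rw [G.map_comp, Category.assoc, ← Functor.LaxMonoidal.μ_natural_assoc,
    μ_comp_map_μ_comp_eq_of_naturality F G H eX eY eXY hfst hsnd, ← Category.assoc,
    MonoidalCategory.tensorHom_comp_tensorHom]

/-- `μ`-prefixed chart shape for a natural isomorphism `e : F ⋙ G ≅ H` of cartesian functors:
`μ_G ≫ G((g ⊗ g′) ≫ μ_F) ≫ e_{X ⊗ Y} = ((G g ≫ e_X) ⊗ (G g′ ≫ e_Y)) ≫ μ_H`. [cite: GortzWedhorn2020, §(4.7)] -/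
theorem NatIso.μ_comp_map_tensorHom_μ_comp_hom_app (e : F ⋙ G ≅ H) {X Y : C} {Z Z' : D}
    (g : Z ⟶ F.obj X) (g' : Z' ⟶ F.obj Y) :
    Functor.LaxMonoidal.μ G Z Z' ≫ G.map ((g ⊗ₘ g') ≫ Functor.LaxMonoidal.μ F X Y) ≫ e.hom.app (X ⊗ Y) =
      ((G.map g ≫ e.hom.app X) ⊗ₘ (G.map g' ≫ e.hom.app Y)) ≫ Functor.LaxMonoidal.μ H X Y :=
  μ_comp_map_tensorHom_μ_comp_eq_of_naturality F G H (e.app X) (e.app Y) (e.app (X ⊗ Y))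
    (e.hom.naturality (fst X Y)) (e.hom.naturality (snd X Y)) g g'

end General

/-! ## §2 The laws of a tower isomorphism `e : bcFunctor k L ⋙ bcFunctor L M ≅ bcFunctor k M` -/

section Tower

open AbelianVariety (bcFunctor)

variable {k L M : Type u} [Field k] [Field L] [Field M] [Algebra k L] [Algebra L M] [Algebra k M]

/-- **Naturality** of a tower isomorphism of base change in `k`-morphisms, consumer spelling:
`((f ⊗_k L) ⊗_L M) ≫ e_Y = e_X ≫ (f ⊗_k M)`. [cite: GortzWedhorn2020, Prop. 4.16 and §(4.7)] -/
theorem bcTower_map_map_comp_app_hom (e : bcFunctor k L ⋙ bcFunctor L M ≅ bcFunctor k M)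
    {X Y : SchemeOver k} (f : X ⟶ Y) :
    (bcFunctor L M).map ((bcFunctor k L).map f) ≫ (e.app Y).hom = (e.app X).hom ≫ (bcFunctor k M).map f :=
  e.hom.naturality f

/-- Naturality, `NatTrans` spelling: `((f ⊗_k L) ⊗_L M) ≫ e.hom_Y = e.hom_X ≫ (f ⊗_k M)`.
[cite: GortzWedhorn2020, Prop. 4.16 and §(4.7)] -/
theorem bcTower_map_map_comp_hom_app (e : bcFunctor k L ⋙ bcFunctor L M ≅ bcFunctor k M)
    {X Y : SchemeOver k} (f : X ⟶ Y) :
    (bcFunctor L M).map ((bcFunctor k L).map f) ≫ e.hom.app Y = e.hom.app X ≫ (bcFunctor k M).map f :=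
  e.hom.naturality f

/-- Naturality of the inverse: `(f ⊗_k M) ≫ e_Y⁻¹ = e_X⁻¹ ≫ ((f ⊗_k L) ⊗_L M)`.
[cite: GortzWedhorn2020, Prop. 4.16 and §(4.7)] -/
theorem bcTower_map_comp_app_inv (e : bcFunctor k L ⋙ bcFunctor L M ≅ bcFunctor k M)
    {X Y : SchemeOver k} (f : X ⟶ Y) :
    (bcFunctor k M).map f ≫ (e.app Y).inv = (e.app X).inv ≫ (bcFunctor L M).map ((bcFunctor k L).map f) :=
  e.inv.naturality f

/-- Naturality **after an arbitrary morphism `m`** (the form that rewrites inside a composite, where the object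
in front of `e_X` is spelled `((X ⊗_k L) ⊗_L M)`): `m ≫ e_X ≫ (f ⊗_k M) = m ≫ ((f ⊗_k L) ⊗_L M) ≫ e_Y`.
[cite: GortzWedhorn2020, Prop. 4.16 and §(4.7)] -/
theorem bcTower_comp_app_hom_comp_map (e : bcFunctor k L ⋙ bcFunctor L M ≅ bcFunctor k M)
    {X Y : SchemeOver k} (f : X ⟶ Y) {W : SchemeOver M} (m : W ⟶ (bcFunctor L M).obj ((bcFunctor k L).obj X)) :
    m ≫ (e.app X).hom ≫ (bcFunctor k M).map f = m ≫ (bcFunctor L M).map ((bcFunctor k L).map f) ≫ (e.app Y).hom :=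
  congrArg (m ≫ ·) (e.hom.naturality f).symm

/-- Naturality behind a chart map `g : Z ⟶ X ⊗_k L`: `((g ⊗_L M) ≫ e_X) ≫ (f ⊗_k M) = ((g ≫ (f ⊗_k L)) ⊗_L M) ≫ e_Y`
(the shape of `f_c ≫ (α ⊗_k M)` for `f_c := (e_c ⊗_L M) ≫ e_X`). [cite: GortzWedhorn2020, Prop. 4.16 and §(4.7)] -/
theorem bcTower_map_comp_app_hom_comp_map (e : bcFunctor k L ⋙ bcFunctor L M ≅ bcFunctor k M)
    {X Y : SchemeOver k} (f : X ⟶ Y) {Z : SchemeOver L} (g : Z ⟶ (bcFunctor k L).obj X) :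
    ((bcFunctor L M).map g ≫ (e.app X).hom) ≫ (bcFunctor k M).map f =
      (bcFunctor L M).map (g ≫ (bcFunctor k L).map f) ≫ (e.app Y).hom := by
  rw [Category.assoc, bcTower_comp_app_hom_comp_map e f, ← Functor.map_comp_assoc]

/-- **A tower isomorphism of base change is monoidal** (consumer spelling): on
`((X ⊗_k L) ⊗_L M) ⊗ ((Y ⊗_k L) ⊗_L M)`, `μ_{LM} ≫ (μ_{kL} ⊗_L M) ≫ e_{X ⊗ Y} = (e_X ⊗ e_Y) ≫ μ_{kM}` — base change
commutes with fibre products compatibly with transitivity. [cite: GortzWedhorn2020, Prop. 4.16 and §(4.7)] -/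
theorem bcTower_μ_comp_map_μ_comp_app_hom (e : bcFunctor k L ⋙ bcFunctor L M ≅ bcFunctor k M)
    (X Y : SchemeOver k) :
    Functor.LaxMonoidal.μ (bcFunctor L M) ((bcFunctor k L).obj X) ((bcFunctor k L).obj Y) ≫
        (bcFunctor L M).map (Functor.LaxMonoidal.μ (bcFunctor k L) X Y) ≫ (e.app (X ⊗ Y)).hom =
      ((e.app X).hom ⊗ₘ (e.app Y).hom) ≫ Functor.LaxMonoidal.μ (bcFunctor k M) X Y :=
  NatIso.μ_comp_map_μ_comp_hom_app _ _ _ e X Y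

/-- Monoidality, `NatTrans` spelling: `μ_{LM} ≫ (μ_{kL} ⊗_L M) ≫ e.hom_{X ⊗ Y} = (e.hom_X ⊗ e.hom_Y) ≫ μ_{kM}`.
[cite: GortzWedhorn2020, Prop. 4.16 and §(4.7)] -/
theorem bcTower_μ_comp_map_μ_comp_hom_app (e : bcFunctor k L ⋙ bcFunctor L M ≅ bcFunctor k M)
    (X Y : SchemeOver k) :
    Functor.LaxMonoidal.μ (bcFunctor L M) ((bcFunctor k L).obj X) ((bcFunctor k L).obj Y) ≫
        (bcFunctor L M).map (Functor.LaxMonoidal.μ (bcFunctor k L) X Y) ≫ e.hom.app (X ⊗ Y) =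
      (e.hom.app X ⊗ₘ e.hom.app Y) ≫ Functor.LaxMonoidal.μ (bcFunctor k M) X Y :=
  NatIso.μ_comp_map_μ_comp_hom_app _ _ _ e X Y

/-- `δ`-form of monoidality: `(δ_{kL} ⊗_L M) ≫ δ_{LM} ≫ (e_X ⊗ e_Y) = e_{X ⊗ Y} ≫ δ_{kM}`.
[cite: GortzWedhorn2020, Prop. 4.16 and §(4.7)] -/
theorem bcTower_map_δ_comp_δ_comp_tensorHom_app_hom (e : bcFunctor k L ⋙ bcFunctor L M ≅ bcFunctor k M)
    (X Y : SchemeOver k) :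
    (bcFunctor L M).map (Functor.OplaxMonoidal.δ (bcFunctor k L) X Y) ≫
        Functor.OplaxMonoidal.δ (bcFunctor L M) ((bcFunctor k L).obj X) ((bcFunctor k L).obj Y) ≫
          ((e.app X).hom ⊗ₘ (e.app Y).hom) =
      (e.app (X ⊗ Y)).hom ≫ Functor.OplaxMonoidal.δ (bcFunctor k M) X Y :=
  NatIso.map_δ_comp_δ_comp_tensorHom_app _ _ _ e X Y

/-- **Chart shape, `μ`-prefixed**: for `g : Z ⟶ X ⊗_k L`, `g′ : Z′ ⟶ Y ⊗_k L` over `L`,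
`μ_{LM} ≫ (((g ⊗ g′) ≫ μ_{kL}) ⊗_L M) ≫ e_{X ⊗ Y} = (((g ⊗_L M) ≫ e_X) ⊗ ((g′ ⊗_L M) ≫ e_Y)) ≫ μ_{kM}` — how a
product chart `(e_c ⊗ e_c) ≫ μ_{kL}` over `L` is moved to `M`. [cite: GortzWedhorn2020, Prop. 4.16 and §(4.7)] -/
theorem bcTower_μ_comp_map_tensorHom_μ_comp_app_hom (e : bcFunctor k L ⋙ bcFunctor L M ≅ bcFunctor k M)
    {X Y : SchemeOver k} {Z Z' : SchemeOver L} (g : Z ⟶ (bcFunctor k L).obj X)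
    (g' : Z' ⟶ (bcFunctor k L).obj Y) :
    Functor.LaxMonoidal.μ (bcFunctor L M) Z Z' ≫
        (bcFunctor L M).map ((g ⊗ₘ g') ≫ Functor.LaxMonoidal.μ (bcFunctor k L) X Y) ≫ (e.app (X ⊗ Y)).hom =
      (((bcFunctor L M).map g ≫ (e.app X).hom) ⊗ₘ ((bcFunctor L M).map g' ≫ (e.app Y).hom)) ≫
        Functor.LaxMonoidal.μ (bcFunctor k M) X Y :=
  NatIso.μ_comp_map_tensorHom_μ_comp_hom_app _ _ _ e g g'

/-- Chart shape, `δ`-prefixed (common source `Z`):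
`(((g ⊗ g′) ≫ μ_{kL}) ⊗_L M) ≫ e_{X ⊗ Y} = δ_{LM} ≫ (((g ⊗_L M) ≫ e_X) ⊗ ((g′ ⊗_L M) ≫ e_Y)) ≫ μ_{kM}`.
[cite: GortzWedhorn2020, Prop. 4.16 and §(4.7)] -/
theorem bcTower_map_tensorHom_μ_comp_app_hom (e : bcFunctor k L ⋙ bcFunctor L M ≅ bcFunctor k M)
    {X Y : SchemeOver k} {Z : SchemeOver L} (g : Z ⟶ (bcFunctor k L).obj X) (g' : Z ⟶ (bcFunctor k L).obj Y) :
    (bcFunctor L M).map ((g ⊗ₘ g') ≫ Functor.LaxMonoidal.μ (bcFunctor k L) X Y) ≫ (e.app (X ⊗ Y)).hom =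
      Functor.OplaxMonoidal.δ (bcFunctor L M) Z Z ≫
        (((bcFunctor L M).map g ≫ (e.app X).hom) ⊗ₘ ((bcFunctor L M).map g' ≫ (e.app Y).hom)) ≫
          Functor.LaxMonoidal.μ (bcFunctor k M) X Y :=
  NatIso.map_tensorHom_comp_μ_comp_hom_app _ _ _ e g g'

/-- **Diagonal chart shape**: `((lift u u′ ≫ (g ⊗ g′) ≫ μ_{kL}) ⊗_L M) ≫ e_{X ⊗ Y} =
lift ((u ⊗_L M) ≫ (g ⊗_L M) ≫ e_X) ((u′ ⊗_L M) ≫ (g′ ⊗_L M) ≫ e_Y) ≫ μ_{kM}` (e.g. `u = 𝟙`, `u′` a constant point: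
`inj_q ≫ αx = lift (𝟙 _) pt ≫ ℓ_q ≫ (α_X)_ℂ` in Liu's Lemma 2.4 (1)). [cite: GortzWedhorn2020, Prop. 4.16 and §(4.7)] -/
theorem bcTower_map_lift_tensorHom_μ_comp_app_hom (e : bcFunctor k L ⋙ bcFunctor L M ≅ bcFunctor k M)
    {X Y : SchemeOver k} {W Z : SchemeOver L} (u u' : W ⟶ Z) (g : Z ⟶ (bcFunctor k L).obj X)
    (g' : Z ⟶ (bcFunctor k L).obj Y) :
    (bcFunctor L M).map (lift u u' ≫ (g ⊗ₘ g') ≫ Functor.LaxMonoidal.μ (bcFunctor k L) X Y) ≫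
        (e.app (X ⊗ Y)).hom =
      lift ((bcFunctor L M).map u ≫ (bcFunctor L M).map g ≫ (e.app X).hom)
          ((bcFunctor L M).map u' ≫ (bcFunctor L M).map g' ≫ (e.app Y).hom) ≫
        Functor.LaxMonoidal.μ (bcFunctor k M) X Y :=
  NatIso.map_lift_tensorHom_comp_μ_comp_hom_app _ _ _ e u u' g g'

/-- **Chart transport along the tower** (the «incl-clause» of an Albanese chart moved from `L` to `M`): if
`l : Z ⊗ Z′ ⟶ N ⊗_k L` lifts `(g ⊗ g′) ≫ μ_{kL}` through `ι ⊗_k L` for some `ι : N ⟶ X ⊗ Y` over `k`, then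
`l_M := μ_{LM} ≫ (l ⊗_L M) ≫ e_N` lifts `((g_M ≫ e_X) ⊗ (g′_M ≫ e_Y)) ≫ μ_{kM}` through `ι ⊗_k M`.
[cite: GortzWedhorn2020, Prop. 4.16 and §(4.7)] -/
theorem bcTower_chart_comp_map_eq (e : bcFunctor k L ⋙ bcFunctor L M ≅ bcFunctor k M)
    {X Y N : SchemeOver k} (ι : N ⟶ X ⊗ Y) {Z Z' : SchemeOver L} (g : Z ⟶ (bcFunctor k L).obj X)
    (g' : Z' ⟶ (bcFunctor k L).obj Y) (l : Z ⊗ Z' ⟶ (bcFunctor k L).obj N)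
    (hl : l ≫ (bcFunctor k L).map ι = (g ⊗ₘ g') ≫ Functor.LaxMonoidal.μ (bcFunctor k L) X Y) :
    (Functor.LaxMonoidal.μ (bcFunctor L M) Z Z' ≫ (bcFunctor L M).map l ≫ (e.app N).hom) ≫
        (bcFunctor k M).map ι =
      (((bcFunctor L M).map g ≫ (e.app X).hom) ⊗ₘ ((bcFunctor L M).map g' ≫ (e.app Y).hom)) ≫
        Functor.LaxMonoidal.μ (bcFunctor k M) X Y := by
  rw [Category.assoc, Category.assoc, bcTower_comp_app_hom_comp_map e ι, ← Functor.map_comp_assoc, hl]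
  exact bcTower_μ_comp_map_tensorHom_μ_comp_app_hom e g g'

end Tower

end Literature.AlgebraicGeometry.Motives

end
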